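import Literature.Analysis.FluidPDE.Seregin2020AxisymmetricTypeII
import Literature.Analysis.FluidPDE.SignedPowers
import Literature.Analysis.FluidPDE.ForwardDSSAprioriAssembly
import Literature.Analysis.FluidPDE.KNSSSwirlTransport
import Summits.NavierStokesRegularity.NavierStokesRegularity.Theorems.AxisymmetricExtremalityAxisymmetricKatoGlobalStubSeregin2020TypeIILemma22InvCylRadius
import HarnessLib

/-!
# Seregin 2020, Lemma 2.2 (after Nazarov–Uraltseva 2012), piece L22-C: tools for the De Giorgi
# atoms — the power test functions `((κ - τ)₊)^p`, scaled cut-offs, and the drift integrals on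
# sub-cylinders

Helper toward the stub `stub_seregin2020TypeII` of the crux `AxisymmetricKatoGlobal` (= the named
fact `Literature.Analysis.FluidPDE.Seregin2020_axisymmetricSingularPoint_typeII`, Seregin 2020,
Thm 2.1, reduced in the tree to Lemma 2.2 = N–U 2012 Lemma 4.2 in class 𝒱). The composition of
piece L22-C (N–U Cor 3.3) is landed (`expansionOfPositivity_of_atoms`); what remains are the three
analytic atoms `lemma22_smallSublevel_lowerBound` (N–U Lemma 3.1), `lemma22_densityPropagation`
(Lemma 3.2), `lemma22_shrinking` (Lemma 3.3), registered on stmt-NavierStokesRegularity-15453 in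
the energy-class formulation (skeleton `Cruxes/AxisymmetricKatoGlobal/Seregin2020Lemma22ExpansionOfPositivity.lean`).
All three test the energy inequality with `H = ((κ - τ)₊)^p` and a cut-off on a ball, and bound
the drift terms by the hypothesis `∫_{-R²}^0 (∫_{B(2R)} |U|³)^{4/3} ≤ N R²` and by
`∫_{B(ρ)} |x'|⁻¹ ≤ C ρ²`. This file provides exactly these shared tools:

* `powerTest_energyClass_props` — `H = ((κ - τ)₊)^p`, `p > 2`, meets the requirements of the
  energy class (`C²`, `H' ≤ 0 ≤ H`, `H'' ≥ 0`, `H'² ≤ 2HH''`, `H = 0` on `[κ, ∞)`), with the value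
  bounds `H ≤ κ^p` on `[0, ∞)` and `H ≥ (κ - ℓ)^p` on `(-∞, ℓ]` (from `Literature/…/SignedPowers`);
* `exists_scaled_cutoff` — for `σ ∈ ]0,1[` a constant `C_σ` and, for every `ρ > 0`, a `C¹` cut-off
  `ζ`, `0 ≤ ζ ≤ 1`, `ζ = 1` on `B((1-σ)ρ)`, `tsupport ζ ⊆ B(ρ)`, `‖∇ζ‖ ≤ C_σ/ρ`
  (rescaled `ContDiffBump`, `BradshawTsai2019.exists_cutoff`);
* `lintegral_inv_cylRadius_cylinder_le` — `∫∫_{[t₁,t₂]×B(ρ)} |x'|⁻¹ ≤ C (t₂ - t₁) ρ²`;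
* `lintegral_norm_drift_cylinder_le` — N–U's use of `‖1‖_{q',ℓ',Q}` (Hölder twice, `q = 3`,
  `ℓ = 4`): `∫∫_{[t₁,t₂]×B(ρ)} |U| ≤ 2 N^{1/4} |B₁|^{-1/3} θ^{3/4} ρ |B(ρ)|` whenever
  `t₂ - t₁ ≤ θρ²`, `R/4 ≤ ρ ≤ 2R`, `[t₁,t₂] ⊆ [-R², 0]`.

## References

* A. I. Nazarov, N. N. Uraltseva, St. Petersburg Math. J. 23 (2012) 93–115 = arXiv:1011.1888,
  §3 (proofs of Lemmas 3.1–3.3: the test functions, the cut-offs, the drift terms). [NazarovUraltseva2012]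
* G. Seregin, Anal. Math. Phys. 10 (2020), Paper 46 = arXiv:2006.04140, Lemma 2.2. [Seregin2020]
-/

-- the problem directory repeats the summit name (D-0017); core's `dupNamespace` linter fires
set_option linter.dupNamespace false

noncomputable section

open MeasureTheory Set Function Filter Topology TopologicalSpace Metric
open scoped NNReal ENNReal

namespace Summit.NavierStokesRegularity.NavierStokesRegularity.Theorems.AxisymmetricKatoGlobal.EulerScaling

open Literature.Analysis.FluidPDE Literature.Analysis.FluidPDE.Seregin2020
  Literature.Analysis.FluidPDE.LeiZhang2011

/-! ### The power test functions -/

/-- **`H = ((κ - τ)₊)^p`, `p > 2`, is admissible for the energy class** (`C²`, nonincreasing,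
nonnegative, convex, `H'² ≤ 2HH''`, vanishing on `[κ, ∞)`), with the two value bounds used by
De Giorgi's arguments: `H(τ) ≤ κ^p` for `τ ≥ 0` and `(κ - ℓ)^p ≤ H(τ)` for `τ ≤ ℓ ≤ κ`.
[cite: NazarovUraltseva2012, §3, proofs of Lemmas 3.1–3.3 (test functions (V-k)₋, τ₊^p)] -/
theorem powerTest_energyClass_props {p κ : ℝ} (hp : 2 < p) (hκ : 0 ≤ κ) :
    ContDiff ℝ 2 (fun x : ℝ => max (κ - x) 0 ^ p) ∧
    (∀ v, deriv (fun x : ℝ => max (κ - x) 0 ^ p) v ≤ 0) ∧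
    (∀ v, 0 ≤ max (κ - v) 0 ^ p) ∧
    (∀ v, 0 ≤ deriv (deriv fun x : ℝ => max (κ - x) 0 ^ p) v) ∧
    (∀ v, deriv (fun x : ℝ => max (κ - x) 0 ^ p) v ^ 2 ≤
      2 * max (κ - v) 0 ^ p * deriv (deriv fun x : ℝ => max (κ - x) 0 ^ p) v) ∧
    (∀ v, κ ≤ v → max (κ - v) 0 ^ p = 0) ∧
    (∀ v, 0 ≤ v → max (κ - v) 0 ^ p ≤ κ ^ p) ∧
    (∀ ℓ v, v ≤ ℓ → ℓ ≤ κ → (κ - ℓ) ^ p ≤ max (κ - v) 0 ^ p) := by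
  have hp0 : 0 < p := by linarith
  refine ⟨contDiff_two_posPart_const_sub_rpow hp κ, fun v => ?_, fun v => posPart_rpow_nonneg _ _,
    deriv_deriv_posPart_const_sub_rpow_nonneg hp κ, fun v => ?_, fun v hv => ?_, fun v hv => ?_,
    fun ℓ v hv hℓ => ?_⟩
  · rw [deriv_posPart_const_sub_rpow hp]
    have : 0 ≤ p * max (κ - v) 0 ^ (p - 1) := mul_nonneg hp0.le (posPart_rpow_nonneg _ _)
    linarith
  · have h := deriv_posPart_const_sub_rpow_sq_le hp κ v
    have hHH : 0 ≤ max (κ - v) 0 ^ p * deriv (deriv fun x : ℝ => max (κ - x) 0 ^ p) v :=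
      mul_nonneg (posPart_rpow_nonneg _ _) (deriv_deriv_posPart_const_sub_rpow_nonneg hp κ v)
    have hc : p / (p - 1) ≤ 2 := by
      rw [div_le_iff₀ (by linarith)]; linarith
    calc _ ≤ p / (p - 1) * (max (κ - v) 0 ^ p * deriv (deriv fun x : ℝ => max (κ - x) 0 ^ p) v) := h
      _ ≤ 2 * (max (κ - v) 0 ^ p * deriv (deriv fun x : ℝ => max (κ - x) 0 ^ p) v) :=
          mul_le_mul_of_nonneg_right hc hHH
      _ = _ := by ring
  · exact posPart_rpow_of_nonpos (by linarith) hp0.ne'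
  · exact Real.rpow_le_rpow (le_max_right _ _) (max_le (by linarith) hκ) hp0.le
  · exact Real.rpow_le_rpow (by linarith) (le_max_of_le_left (by linarith)) hp0.le

/-! ### Scaled cut-offs -/

/-- **Scaled cut-offs on balls with a gradient bound.** For `σ ∈ ]0,1[` there is `C ≥ 0` such
that for every `ρ > 0` there is `ζ ∈ C¹(ℝ³)` of compact support with `0 ≤ ζ ≤ 1`, `ζ = 1` on
`B((1-σ)ρ)`, `tsupport ζ ⊆ B(ρ)` and `‖Dζ‖ ≤ C/ρ` everywhere (N–U: "`ζ ≡ 1` in `B_{(1-σ)R}` and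
`|Dζ| ≤ 2/(σR)`"; here by rescaling a fixed smooth bump). [cite: NazarovUraltseva2012, proof of Lemma 3.2 (choice of ζ)] -/
theorem exists_scaled_cutoff {σ : ℝ} (hσ : 0 < σ) (hσ1 : σ < 1) :
    ∃ C : ℝ, 0 ≤ C ∧ ∀ ρ : ℝ, 0 < ρ →
      ∃ ζ : EuclideanSpace ℝ (Fin 3) → ℝ, ContDiff ℝ 1 ζ ∧ HasCompactSupport ζ ∧
        (∀ x, 0 ≤ ζ x ∧ ζ x ≤ 1) ∧
        (∀ x ∈ ball (0 : EuclideanSpace ℝ (Fin 3)) ((1 - σ) * ρ), ζ x = 1) ∧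
        tsupport ζ ⊆ ball (0 : EuclideanSpace ℝ (Fin 3)) ρ ∧
        ∀ x, ‖fderiv ℝ ζ x‖ ≤ C / ρ := by
  have hc : 1 < 1 / (1 - σ) := by
    rw [lt_div_iff₀ (by linarith)]; linarith
  obtain ⟨χ, hχs, hχc, hχ01, hχ1, hχ0, M, hM⟩ := BradshawTsai2019.exists_cutoff hc
  have hM0 : 0 ≤ M := (norm_nonneg _).trans (hM 0)
  refine ⟨M / (1 - σ), div_nonneg hM0 (by linarith), fun ρ hρ => ?_⟩
  set a : ℝ := 1 / ((1 - σ) * ρ) with ha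
  have hσρ : 0 < (1 - σ) * ρ := mul_pos (by linarith) hρ
  have ha0 : 0 < a := by rw [ha]; positivity
  refine ⟨fun x => χ (a • x), ?_, ?_, fun x => hχ01 _, fun x hx => ?_, ?_, fun x => ?_⟩
  · exact (hχs.of_le (by norm_cast)).comp (contDiff_const_smul a)
  · -- compact support: `χ ∘ (a • ·)` vanishes off a bounded set
    refine HasCompactSupport.of_support_subset_isCompact (isCompact_closedBall (0 : EuclideanSpace ℝ (Fin 3))
      ((1 + 1 / (1 - σ)) / 2 / a)) fun x hx => ?_
    rw [mem_closedBall, dist_zero_right]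
    by_contra hlt
    push Not at hlt
    apply hx
    apply hχ0
    rw [norm_smul, Real.norm_of_nonneg ha0.le]
    rw [div_lt_iff₀ ha0] at hlt
    linarith
  · apply hχ1
    rw [mem_ball, dist_zero_right, norm_smul, Real.norm_of_nonneg ha0.le, ha]
    rw [mem_ball, dist_zero_right] at hx
    rw [div_mul_eq_mul_div, one_mul, div_lt_one hσρ]
    exact hx
  · -- `tsupport ⊆ closedBall ((1 - σ/2) ρ) ⊆ ball ρ`
    have hsupp : support (fun x => χ (a • x)) ⊆
        closedBall (0 : EuclideanSpace ℝ (Fin 3)) ((1 - σ / 2) * ρ) := by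
      intro x hx
      rw [mem_closedBall, dist_zero_right]
      by_contra hlt
      push Not at hlt
      apply hx
      apply hχ0
      rw [norm_smul, Real.norm_of_nonneg ha0.le, ha]
      have h1σ : (1 - σ) ≠ 0 := by
        intro h; linarith
      have e : (1 + 1 / (1 - σ)) / 2 = (1 / ((1 - σ) * ρ)) * ((1 - σ / 2) * ρ) := by
        field_simp
        ring
      rw [e]
      exact mul_le_mul_of_nonneg_left hlt.le (by positivity)
    refine (closure_minimal hsupp isClosed_closedBall).trans ?_
    exact closedBall_subset_ball (by nlinarith)
  · have hχ1' : ContDiff ℝ 1 χ := hχs.of_le (by exact_mod_cast le_top)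
    have h1 : HasFDerivAt (fun y : EuclideanSpace ℝ (Fin 3) => a • y)
        (a • ContinuousLinearMap.id ℝ (EuclideanSpace ℝ (Fin 3))) x :=
      (hasFDerivAt_id x).const_smul a
    have h2 : HasFDerivAt χ (fderiv ℝ χ (a • x)) (a • x) :=
      ((hχ1'.differentiable one_ne_zero) _).hasFDerivAt
    have h3 : HasFDerivAt (fun y : EuclideanSpace ℝ (Fin 3) => χ (a • y))
        ((fderiv ℝ χ (a • x)).comp (a • ContinuousLinearMap.id ℝ (EuclideanSpace ℝ (Fin 3)))) x :=
      h2.comp x h1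
    rw [h3.fderiv]
    calc ‖(fderiv ℝ χ (a • x)).comp (a • ContinuousLinearMap.id ℝ (EuclideanSpace ℝ (Fin 3)))‖
        ≤ ‖fderiv ℝ χ (a • x)‖ * ‖a • ContinuousLinearMap.id ℝ (EuclideanSpace ℝ (Fin 3))‖ :=
          ContinuousLinearMap.opNorm_comp_le _ _
      _ ≤ M * (‖a‖ * 1) := by
          refine mul_le_mul (hM _) ?_ (norm_nonneg _) hM0
          rw [norm_smul]
          exact mul_le_mul_of_nonneg_left ContinuousLinearMap.norm_id_le (norm_nonneg _)
      _ = M / (1 - σ) / ρ := by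
          rw [Real.norm_of_nonneg ha0.le, ha]
          field_simp


/-! ### The singular drift on cylinders -/

/-- **`∫∫_{[t₁,t₂]×B(ρ)} |x'|⁻¹ ≤ C (t₂ - t₁) ρ²`** (Tonelli and the slice bound
`lintegral_inv_cylRadius_rpow_ball_le` with `q = 1`): the axis drift `2x'/|x'|²` is integrable on
parabolic cylinders with the scale-invariant bound. [cite: NazarovUraltseva2012, §4 before Thm 4.1 (the drift 2x'/|x'|² ∈ L_{q,∞}, q < 2)] -/
theorem lintegral_inv_cylRadius_cylinder_le : ∃ C : ℝ≥0, ∀ (t₁ t₂ ρ : ℝ), t₁ ≤ t₂ → 0 < ρ →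
    ∫⁻ z in Icc t₁ t₂ ×ˢ ball (0 : EuclideanSpace ℝ (Fin 3)) ρ, ENNReal.ofReal ((cylRadius z.2)⁻¹)
      ≤ (C : ℝ≥0∞) * ENNReal.ofReal ((t₂ - t₁) * ρ ^ 2) := by
  obtain ⟨C, hC⟩ := lintegral_inv_cylRadius_rpow_ball_le 1 zero_le_one one_lt_two
  refine ⟨C, fun t₁ t₂ ρ ht hρ => ?_⟩
  have hball := hC 0 ρ hρ
  rw [Measure.volume_eq_prod, ← Measure.prod_restrict]
  refine (lintegral_prod_le _).trans ?_
  have hinner : ∀ t : ℝ, ∫⁻ y in ball (0 : EuclideanSpace ℝ (Fin 3)) ρ,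
      ENNReal.ofReal ((cylRadius ((t, y) : ℝ × EuclideanSpace ℝ (Fin 3)).2)⁻¹)
        ≤ (C : ℝ≥0∞) * ENNReal.ofReal (ρ ^ 2) := by
    intro t
    refine le_trans (le_of_eq ?_) (hball.trans_eq ?_)
    · refine lintegral_congr_ae (ae_of_all _ fun y => ?_)
      simp only [Real.rpow_neg_one]
    · norm_num
  calc ∫⁻ t in Icc t₁ t₂, ∫⁻ y in ball (0 : EuclideanSpace ℝ (Fin 3)) ρ,
        ENNReal.ofReal ((cylRadius ((t, y) : ℝ × EuclideanSpace ℝ (Fin 3)).2)⁻¹)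
      ≤ ∫⁻ _ in Icc t₁ t₂, (C : ℝ≥0∞) * ENNReal.ofReal (ρ ^ 2) := lintegral_mono fun t => hinner t
    _ = (C : ℝ≥0∞) * ENNReal.ofReal (ρ ^ 2) * volume (Icc t₁ t₂) := setLIntegral_const _ _
    _ = (C : ℝ≥0∞) * ENNReal.ofReal ((t₂ - t₁) * ρ ^ 2) := by
        rw [Real.volume_Icc, mul_assoc, ← ENNReal.ofReal_mul (by positivity), mul_comm (ρ ^ 2)]

/-! ### The drift on cylinders: Hölder twice -/

/-- The elementary inequality behind `lintegral_norm_drift_cylinder_le`: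
`((NR²)^{3/4}(θρ²)^{1/4})^{1/3}((θρ²)(ρ³v))^{2/3} ≤ 2N^{1/4}v^{-1/3}(θ^{3/4}ρ)(ρ³v)` for `R ≤ 4ρ`
(both sides are `N^{1/4}v^{2/3}θ^{3/4}` times `R^{1/2}ρ^{7/2} ≤ 2ρ⁴`). [folklore] -/
theorem drift_real_ineq (N v θ ρ R : ℝ) (hN : 0 ≤ N) (hv : 0 < v) (hθ : 0 < θ) (hρ : 0 < ρ)
    (hR : 0 < R) (hRρ : R ≤ 4 * ρ) :
    ((N * R ^ 2) ^ (3 / 4 : ℝ) * (θ * ρ ^ 2) ^ (1 / 4 : ℝ)) ^ (1 / 3 : ℝ) *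
        ((θ * ρ ^ 2) * (ρ ^ 3 * v)) ^ (2 / 3 : ℝ) ≤
      2 * N ^ (1 / 4 : ℝ) * v ^ (-(1 / 3) : ℝ) * (θ ^ (3 / 4 : ℝ) * ρ) * (ρ ^ 3 * v) := by
  -- common factor `A = N^{1/4} v^{2/3} θ^{3/4}`
  have hR2 : 0 ≤ N * R ^ 2 := by positivity
  have hθρ : 0 ≤ θ * ρ ^ 2 := by positivity
  have hρv : 0 ≤ ρ ^ 3 * v := by positivity
  -- rewrite the left-hand side
  have e1 : ((N * R ^ 2) ^ (3 / 4 : ℝ) * (θ * ρ ^ 2) ^ (1 / 4 : ℝ)) ^ (1 / 3 : ℝ) =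
      (N * R ^ 2) ^ (1 / 4 : ℝ) * (θ * ρ ^ 2) ^ (1 / 12 : ℝ) := by
    rw [Real.mul_rpow (by positivity) (by positivity), ← Real.rpow_mul hR2, ← Real.rpow_mul hθρ]
    norm_num
  have e2 : ((θ * ρ ^ 2) * (ρ ^ 3 * v)) ^ (2 / 3 : ℝ) = (θ * ρ ^ 2) ^ (2 / 3 : ℝ) * (ρ ^ 3 * v) ^ (2 / 3 : ℝ) :=
    Real.mul_rpow hθρ hρv
  have e3 : (θ * ρ ^ 2) ^ (1 / 12 : ℝ) * (θ * ρ ^ 2) ^ (2 / 3 : ℝ) = (θ * ρ ^ 2) ^ (3 / 4 : ℝ) := by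
    rw [← Real.rpow_add (by positivity)]; norm_num
  have eN : (N * R ^ 2) ^ (1 / 4 : ℝ) = N ^ (1 / 4 : ℝ) * R ^ (1 / 2 : ℝ) := by
    rw [Real.mul_rpow hN (by positivity), ← Real.rpow_natCast R 2, ← Real.rpow_mul hR.le]; norm_num
  have eθ : (θ * ρ ^ 2) ^ (3 / 4 : ℝ) = θ ^ (3 / 4 : ℝ) * ρ ^ (3 / 2 : ℝ) := by
    rw [Real.mul_rpow hθ.le (by positivity), ← Real.rpow_natCast ρ 2, ← Real.rpow_mul hρ.le]; norm_num
  have eρ : (ρ ^ 3 * v) ^ (2 / 3 : ℝ) = ρ ^ (2 : ℝ) * v ^ (2 / 3 : ℝ) := by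
    rw [Real.mul_rpow (by positivity) hv.le, ← Real.rpow_natCast ρ 3, ← Real.rpow_mul hρ.le]; norm_num
  have ev : v ^ (-(1 / 3) : ℝ) * v = v ^ (2 / 3 : ℝ) := by
    conv_lhs => rw [show v ^ (-(1 / 3) : ℝ) * v = v ^ (-(1 / 3) : ℝ) * v ^ (1 : ℝ) by rw [Real.rpow_one]]
    rw [← Real.rpow_add hv]; norm_num
  -- the left-hand side as `A * R^{1/2} * ρ^{7/2}` and the right-hand side as `A * 2 ρ^4`
  have lhs : ((N * R ^ 2) ^ (3 / 4 : ℝ) * (θ * ρ ^ 2) ^ (1 / 4 : ℝ)) ^ (1 / 3 : ℝ) *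
        ((θ * ρ ^ 2) * (ρ ^ 3 * v)) ^ (2 / 3 : ℝ) =
      (N ^ (1 / 4 : ℝ) * v ^ (2 / 3 : ℝ) * θ ^ (3 / 4 : ℝ)) * (R ^ (1 / 2 : ℝ) * (ρ ^ (3 / 2 : ℝ) * ρ ^ (2 : ℝ))) := by
    rw [e1, e2, ← mul_assoc, mul_assoc ((N * R ^ 2) ^ (1 / 4 : ℝ)), e3, eN, eθ, eρ]; ring
  have rhs : 2 * N ^ (1 / 4 : ℝ) * v ^ (-(1 / 3) : ℝ) * (θ ^ (3 / 4 : ℝ) * ρ) * (ρ ^ 3 * v) =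
      (N ^ (1 / 4 : ℝ) * v ^ (2 / 3 : ℝ) * θ ^ (3 / 4 : ℝ)) * (2 * (ρ * ρ ^ 3)) := by
    rw [← ev]; ring
  rw [lhs, rhs]
  have hA : 0 ≤ N ^ (1 / 4 : ℝ) * v ^ (2 / 3 : ℝ) * θ ^ (3 / 4 : ℝ) := by positivity
  refine mul_le_mul_of_nonneg_left ?_ hA
  -- `R^{1/2} ρ^{7/2} ≤ 2 ρ^4`
  have hρ72 : ρ ^ (3 / 2 : ℝ) * ρ ^ (2 : ℝ) = ρ ^ (7 / 2 : ℝ) := by rw [← Real.rpow_add hρ]; norm_num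
  have hρ4 : ρ * ρ ^ 3 = ρ ^ (1 / 2 : ℝ) * ρ ^ (7 / 2 : ℝ) := by
    rw [← Real.rpow_add hρ, show ((1 : ℝ) / 2 + 7 / 2) = 4 by norm_num]
    rw [show ((4 : ℝ)) = ((4 : ℕ) : ℝ) by norm_num, Real.rpow_natCast]; ring
  rw [hρ72, hρ4]
  have hR12 : R ^ (1 / 2 : ℝ) ≤ 2 * ρ ^ (1 / 2 : ℝ) := by
    calc R ^ (1 / 2 : ℝ) ≤ (4 * ρ) ^ (1 / 2 : ℝ) := Real.rpow_le_rpow hR.le hRρ (by norm_num)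
      _ = 4 ^ (1 / 2 : ℝ) * ρ ^ (1 / 2 : ℝ) := Real.mul_rpow (by norm_num) hρ.le
      _ = 2 * ρ ^ (1 / 2 : ℝ) := by
          rw [show (4 : ℝ) = 2 ^ (2 : ℝ) by norm_num, ← Real.rpow_mul (by norm_num)]; norm_num
  have hρ72pos : 0 ≤ ρ ^ (7 / 2 : ℝ) := by positivity
  calc R ^ (1 / 2 : ℝ) * ρ ^ (7 / 2 : ℝ) ≤ (2 * ρ ^ (1 / 2 : ℝ)) * ρ ^ (7 / 2 : ℝ) :=
        mul_le_mul_of_nonneg_right hR12 hρ72pos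
    _ = 2 * (ρ ^ (1 / 2 : ℝ) * ρ ^ (7 / 2 : ℝ)) := by ring


/-- **N–U's drift term on a sub-cylinder** ("`‖b‖_{q,ℓ,Q}‖1‖_{q',ℓ',Q^{1,θ}}`", `q = 3`, `ℓ = 4`):
for a drift constant `N` there is `K` such that, whenever
`∫_{-R²}^0 (∫_{B(2R)} |U|³)^{4/3} ≤ N R²`, for every window `[t₁,t₂] ⊆ [-R², 0]` of length
`≤ θρ²` and every radius `R/4 ≤ ρ ≤ 2R`: `∫∫_{[t₁,t₂]×B(ρ)} |U| ≤ K θ^{3/4} ρ |B(ρ)|`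
(Hölder in space–time with exponents `3, 3/2`, then in time with `4/3, 4`; `K = 2N^{1/4}|B₁|^{-1/3}`).
[cite: NazarovUraltseva2012, proof of Lemma 3.2 (the term ‖b‖‖1‖) and Lemma 3.1 (3.3)] -/
theorem lintegral_norm_drift_cylinder_le : ∀ N : ℝ≥0, ∃ K : ℝ≥0,
    ∀ (U : ℝ → EuclideanSpace ℝ (Fin 3) → EuclideanSpace ℝ (Fin 3)),
      AEStronglyMeasurable (uncurry U) volume →
    ∀ (R ρ θ t₁ t₂ : ℝ), 0 < R → R / 4 ≤ ρ → ρ ≤ 2 * R → 0 < θ → -R ^ 2 ≤ t₁ → t₁ ≤ t₂ → t₂ ≤ 0 →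
      t₂ - t₁ ≤ θ * ρ ^ 2 →
      (∫⁻ s in Ioo (-R ^ 2) 0, (∫⁻ y in ball (0 : EuclideanSpace ℝ (Fin 3)) (2 * R),
          ‖U s y‖ₑ ^ (3 : ℕ)) ^ (4 / 3 : ℝ) ≤ (N : ℝ≥0∞) * ENNReal.ofReal R ^ 2) →
      ∫⁻ z in Icc t₁ t₂ ×ˢ ball (0 : EuclideanSpace ℝ (Fin 3)) ρ, ‖U z.1 z.2‖ₑ
        ≤ (K : ℝ≥0∞) * ENNReal.ofReal (θ ^ (3 / 4 : ℝ) * ρ) *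
          volume (ball (0 : EuclideanSpace ℝ (Fin 3)) ρ) := by
  intro N
  -- the unit ball
  have hV0 : 0 < volume (ball (0 : EuclideanSpace ℝ (Fin 3)) 1) := measure_ball_pos volume 0 one_pos
  have hVtop : volume (ball (0 : EuclideanSpace ℝ (Fin 3)) 1) < ∞ := measure_ball_lt_top
  obtain ⟨v, hv⟩ : ∃ v : ℝ, v = (volume (ball (0 : EuclideanSpace ℝ (Fin 3)) 1)).toReal := ⟨_, rfl⟩
  have hvpos : 0 < v := by rw [hv]; exact ENNReal.toReal_pos hV0.ne' hVtop.ne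
  have hVeq : volume (ball (0 : EuclideanSpace ℝ (Fin 3)) 1) = ENNReal.ofReal v := by
    rw [hv, ENNReal.ofReal_toReal hVtop.ne]
  refine ⟨(2 * (N : ℝ) ^ (1 / 4 : ℝ) * v ^ (-(1 / 3) : ℝ)).toNNReal, ?_⟩
  have hkpos : 0 ≤ 2 * (N : ℝ) ^ (1 / 4 : ℝ) * v ^ (-(1 / 3) : ℝ) := by positivity
  intro U hU R ρ θ t₁ t₂ hR hRρ hρR hθ ht₁ ht₁₂ ht₂ hlen hdrift
  have hρ : 0 < ρ := lt_of_lt_of_le (by positivity) hRρ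
  -- notation
  set I : Set ℝ := Icc t₁ t₂ with hI
  set B : Set (EuclideanSpace ℝ (Fin 3)) := ball 0 ρ with hB
  set B₂ : Set (EuclideanSpace ℝ (Fin 3)) := ball 0 (2 * R) with hB₂
  have hBB₂ : B ⊆ B₂ := ball_subset_ball hρR
  have hf : AEMeasurable (fun z : ℝ × EuclideanSpace ℝ (Fin 3) => ‖U z.1 z.2‖ₑ) volume :=
    hU.enorm
  -- Step A: Hölder on the cylinder with exponents `3, 3/2`
  have h3 : (3 : ℝ).HolderConjugate (3 / 2) := by rw [Real.holderConjugate_iff]; norm_num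
  have hA : ∫⁻ z in I ×ˢ B, ‖U z.1 z.2‖ₑ ≤
      (∫⁻ z in I ×ˢ B, ‖U z.1 z.2‖ₑ ^ (3 : ℝ)) ^ (1 / 3 : ℝ) * (volume (I ×ˢ B)) ^ (2 / 3 : ℝ) := by
    have h := ENNReal.lintegral_mul_le_Lp_mul_Lq (volume.restrict (I ×ˢ B)) h3
      (hf.restrict) (g := fun _ => 1) aemeasurable_const
    simp only [Pi.mul_apply, mul_one, ENNReal.one_rpow, lintegral_const, Measure.restrict_apply_univ,
      one_div, one_mul] at h
    rw [show ((3 : ℝ) / 2)⁻¹ = 2 / 3 by norm_num] at h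
    simpa only [one_div] using h
  -- Step B: Tonelli, `∫∫_{I×B} |U|³ ≤ ∫_I F`, `F(t) = ∫_{B(2R)} |U(t)|³`
  have hF : AEMeasurable (fun t : ℝ => ∫⁻ y in B₂, ‖U t y‖ₑ ^ (3 : ℕ)) (volume.restrict I) := by
    have h := (hf.pow_const (3 : ℕ)).restrict (s := I ×ˢ B₂)
    rw [Measure.volume_eq_prod, ← Measure.prod_restrict] at h
    exact h.lintegral_prod_right'
  have hB' : ∫⁻ z in I ×ˢ B, ‖U z.1 z.2‖ₑ ^ (3 : ℝ) ≤ ∫⁻ t in I, ∫⁻ y in B₂, ‖U t y‖ₑ ^ (3 : ℕ) := by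
    calc ∫⁻ z in I ×ˢ B, ‖U z.1 z.2‖ₑ ^ (3 : ℝ)
        ≤ ∫⁻ z in I ×ˢ B₂, ‖U z.1 z.2‖ₑ ^ (3 : ℝ) :=
          lintegral_mono_set (prod_mono Subset.rfl hBB₂)
      _ = ∫⁻ z in I ×ˢ B₂, ‖U z.1 z.2‖ₑ ^ (3 : ℕ) := by
          refine lintegral_congr_ae (ae_of_all _ fun z => ?_)
          exact ENNReal.rpow_natCast _ 3
      _ ≤ ∫⁻ t in I, ∫⁻ y in B₂, ‖U t y‖ₑ ^ (3 : ℕ) := by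
          rw [Measure.volume_eq_prod, ← Measure.prod_restrict]
          exact lintegral_prod_le _
  -- Step C: Hölder in time with exponents `4/3, 4`
  have h43 : (4 / 3 : ℝ).HolderConjugate 4 := by rw [Real.holderConjugate_iff]; norm_num
  have hC : ∫⁻ t in I, ∫⁻ y in B₂, ‖U t y‖ₑ ^ (3 : ℕ) ≤
      (∫⁻ t in I, (∫⁻ y in B₂, ‖U t y‖ₑ ^ (3 : ℕ)) ^ (4 / 3 : ℝ)) ^ (3 / 4 : ℝ) *
        (volume I) ^ (1 / 4 : ℝ) := by
    have h := ENNReal.lintegral_mul_le_Lp_mul_Lq (volume.restrict I) h43 hF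
      (g := fun _ => 1) aemeasurable_const
    simp only [Pi.mul_apply, mul_one, ENNReal.one_rpow, lintegral_const, Measure.restrict_apply_univ,
      one_div, one_mul] at h
    rw [show ((4 : ℝ) / 3)⁻¹ = 3 / 4 by norm_num] at h
    simpa only [one_div] using h
  -- Step D: the drift hypothesis on `I ⊆ [-R², 0]`
  have hD : ∫⁻ t in I, (∫⁻ y in B₂, ‖U t y‖ₑ ^ (3 : ℕ)) ^ (4 / 3 : ℝ) ≤ (N : ℝ≥0∞) * ENNReal.ofReal R ^ 2 := by
    refine le_trans ?_ hdrift
    have hIJ : I ⊆ Icc (-R ^ 2) 0 := Icc_subset_Icc ht₁ ht₂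
    calc ∫⁻ t in I, (∫⁻ y in B₂, ‖U t y‖ₑ ^ (3 : ℕ)) ^ (4 / 3 : ℝ)
        ≤ ∫⁻ t in Icc (-R ^ 2) 0, (∫⁻ y in B₂, ‖U t y‖ₑ ^ (3 : ℕ)) ^ (4 / 3 : ℝ) :=
          lintegral_mono_set hIJ
      _ = ∫⁻ t in Ioo (-R ^ 2) 0, (∫⁻ y in B₂, ‖U t y‖ₑ ^ (3 : ℕ)) ^ (4 / 3 : ℝ) := by
          rw [Measure.restrict_congr_set Ioo_ae_eq_Icc]
  -- Step E: assembling the ENNReal bound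
  have hvolI : volume I = ENNReal.ofReal (t₂ - t₁) := by rw [hI, Real.volume_Icc]
  have hvolB : volume B = ENNReal.ofReal (ρ ^ 3 * v) := by
    have h3 : Module.finrank ℝ (EuclideanSpace ℝ (Fin 3)) = 3 := by simp
    rw [hB, Measure.addHaar_ball volume 0 hρ.le, h3, hVeq, ← ENNReal.ofReal_mul (by positivity)]
  have hvolIB : volume (I ×ˢ B) = ENNReal.ofReal ((t₂ - t₁) * (ρ ^ 3 * v)) := by
    rw [Measure.volume_eq_prod, Measure.prod_prod, hvolI, hvolB, ← ENNReal.ofReal_mul (by linarith)]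
  have hmain : ∫⁻ z in I ×ˢ B, ‖U z.1 z.2‖ₑ ≤
      ENNReal.ofReal ((((N : ℝ) * R ^ 2) ^ (3 / 4 : ℝ) * (θ * ρ ^ 2) ^ (1 / 4 : ℝ)) ^ (1 / 3 : ℝ) *
        ((θ * ρ ^ 2) * (ρ ^ 3 * v)) ^ (2 / 3 : ℝ)) := by
    refine hA.trans ?_
    have h1 : (∫⁻ z in I ×ˢ B, ‖U z.1 z.2‖ₑ ^ (3 : ℝ)) ≤
        ENNReal.ofReal (((N : ℝ) * R ^ 2) ^ (3 / 4 : ℝ) * (θ * ρ ^ 2) ^ (1 / 4 : ℝ)) := by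
      refine hB'.trans (hC.trans ?_)
      have hN : (∫⁻ t in I, (∫⁻ y in B₂, ‖U t y‖ₑ ^ (3 : ℕ)) ^ (4 / 3 : ℝ)) ^ (3 / 4 : ℝ) ≤
          ENNReal.ofReal (((N : ℝ) * R ^ 2) ^ (3 / 4 : ℝ)) := by
        refine (ENNReal.rpow_le_rpow hD (by norm_num)).trans (le_of_eq ?_)
        rw [← ENNReal.ofReal_rpow_of_nonneg (by positivity) (by norm_num)]
        congr 1
        rw [ENNReal.ofReal_mul (by positivity), ENNReal.ofReal_coe_nnreal, ENNReal.ofReal_pow hR.le]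
      have hI4 : (volume I) ^ (1 / 4 : ℝ) ≤ ENNReal.ofReal ((θ * ρ ^ 2) ^ (1 / 4 : ℝ)) := by
        rw [hvolI, ENNReal.ofReal_rpow_of_nonneg (by linarith) (by norm_num)]
        exact ENNReal.ofReal_le_ofReal (Real.rpow_le_rpow (by linarith) hlen (by norm_num))
      calc _ ≤ ENNReal.ofReal (((N : ℝ) * R ^ 2) ^ (3 / 4 : ℝ)) * ENNReal.ofReal ((θ * ρ ^ 2) ^ (1 / 4 : ℝ)) :=
            mul_le_mul' hN hI4
        _ = _ := by rw [← ENNReal.ofReal_mul (by positivity)]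
    have h2 : (volume (I ×ˢ B)) ^ (2 / 3 : ℝ) ≤ ENNReal.ofReal (((θ * ρ ^ 2) * (ρ ^ 3 * v)) ^ (2 / 3 : ℝ)) := by
      rw [hvolIB, ENNReal.ofReal_rpow_of_nonneg (by positivity) (by norm_num)]
      exact ENNReal.ofReal_le_ofReal (Real.rpow_le_rpow (by positivity)
        (mul_le_mul_of_nonneg_right hlen (by positivity)) (by norm_num))
    calc _ ≤ (ENNReal.ofReal (((N : ℝ) * R ^ 2) ^ (3 / 4 : ℝ) * (θ * ρ ^ 2) ^ (1 / 4 : ℝ))) ^ (1 / 3 : ℝ) *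
          ENNReal.ofReal (((θ * ρ ^ 2) * (ρ ^ 3 * v)) ^ (2 / 3 : ℝ)) :=
          mul_le_mul' (ENNReal.rpow_le_rpow h1 (by norm_num)) h2
      _ = _ := by
          rw [ENNReal.ofReal_rpow_of_nonneg (by positivity) (by norm_num), ← ENNReal.ofReal_mul (by positivity)]
  -- Step F: the real inequality
  refine hmain.trans ?_
  rw [hvolB, ENNReal.coe_nnreal_eq, Real.coe_toNNReal _ hkpos, ← ENNReal.ofReal_mul hkpos,
    ← ENNReal.ofReal_mul (by positivity)]
  exact ENNReal.ofReal_le_ofReal (drift_real_ineq N v θ ρ R N.2 hvpos hθ hρ hR (by linarith))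

end Summit.NavierStokesRegularity.NavierStokesRegularity.Theorems.AxisymmetricKatoGlobal.EulerScaling

end
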